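import Literature.MeasureTheory.Group.InvariantFunctionalLocallyConstant   -- ★ COINV-1 (p849044∕p849065): `isOpenPosMeasure_of_smulInvariantMeasure_ne_zero` (§1 rider :67)
import Literature.NumberTheory.Automorphic.LocalOrbitalIntegrand            -- ★ `orbitalIntegral`, `classOrbitalIntegral`, `OrbitalMeasureFamily`, `descConj`, `range_descConj_id`
import Literature.NumberTheory.Automorphic.InvariantMeasureDomination       -- ★ `isOpenMap_smul_quotient`, `continuous_smul_quotient` (orbit maps of `G` on `G ⧸ H` are open ∕ continuous)
import HarnessLib

/-!
# TRANSPORT OF AN INVARIANT ORBITAL MEASURE TO THE ORBIT: `μ ↦ μ.map e` along a conjugation-equivariant homeomorphism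
# `e : G ⧸ C(γ) ≃ₜ 𝒪(γ)` (invariance, finiteness on compacta, positivity on opens, open orbit maps, change of variables)

Topic `MeasureTheory/Group`; namespace `Literature.MeasureTheory.Group`.  THEOREMS ONLY (no definition, no instance, no notation, no named
fact, no `sorry`).  Cell `pub/hodgecm-mathlib`, crux H413 (`stmt-HodgeConjecture-24833`), line LH4 «Shalika germs», organ ‹ORBIT-TRANSPORT› (LH4-plan (g2)
DEALER WORDS #7 (b), 2026-09-02), author LH10-p01 (g2).  Generic: any topological group `G` with Borel σ-algebras.

WHY.  The Howe ∕ Harish-Chandra finiteness argument for invariant distributions on the unipotent variety ([Rogawski1990, §8.1 p. 113];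
[BernsteinZelevinsky1976, §1.18]) runs the uniqueness of invariant functionals (★ COINV-1 `exists_forall_apply_eq_const_mul_integral_of_smul_invariant`)
on ONE conjugacy class `𝒪(γ)` viewed as a homogeneous `G`-space, against «the» invariant measure ON THE CLASS; the tree's orbital integrals
`orbitalIntegral γ F μ = ∫_{G ⧸ C(γ)} F(y γ y⁻¹) dμ(y)` (★ `LocalOrbitalIntegral`) live on the coset space `G ⧸ C(γ)` instead.  Given the orbit
homeomorphism `e : G ⧸ C(γ) ≃ₜ 𝒪(γ)`, `e(yC) = y γ y⁻¹` — available for CLOSED classes (★ `ConjClassClosedEmbedding`) and for LOCALLY CLOSED classes,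
e.g. the unipotent classes of a reductive `p`-adic group (Glimm–Effros; ★-pending `ConjClassLocallyClosedEmbedding`, LH4-p03) — this file moves every
piece of structure across `e`: the push-forward `μ.map e` of an invariant measure `μ` on `G ⧸ C(γ)` finite on compacta is an invariant Radon measure on the
class, positive on non-empty relatively open sets when `μ ≠ 0`, the conjugation orbit maps into the class are open and the action is transitive (the
hypotheses of COINV-1), and `∫_{𝒪(γ)} F d(μ.map e) = orbitalIntegral γ F μ` with matching integrability.  The homeomorphism `e` is a HYPOTHESIS here.

CURRENCY (serves every consumer spelling).  The class is an ARBITRARY set `O : Set G` carrying `e : G ⧸ C(γ) ≃ₜ ↥O` with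
`he : ∀ g, (e (QuotientGroup.mk g) : G) = g * γ * g⁻¹`; then `O = {x | ∃ y, y γ y⁻¹ = x}` automatically (`eq_setOf_conj_of_orbitMap`), so `O` may be spelled
`{x | ∃ y, y * γ * y⁻¹ = x}`, `Set.range (descConj γ C(γ) _ id)` or `MulAction.orbit (ConjAct G) γ`.  Mathlib has no global instance for the conjugation action
of `G` on `↥O` (its `G`-action on `G` is left multiplication), so invariance ∕ transitivity ∕ open orbit maps are given (a) INSTANCE-FREE, for the explicit maps
`x ↦ g x g⁻¹`, and (b) for ANY action instance the consumer brings: a group `Γ` with `[MulAction Γ ↥O]`, a map `φ : G → Γ` and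
`hsmul : ∀ g x, ((φ g • x : ↥O) : G) = g * x * g⁻¹` — e.g. `Γ := ConjAct G`, `φ := ConjAct.toConjAct` (Mathlib's `MulAction (ConjAct G) ↥(MulAction.orbit (ConjAct G) γ)`,
`hsmul` by `rfl`), or `Γ := G` with a locally built conjugation action.

CONTENTS (common data: `γ : G`, `e`, `he`, a measure `μ` on `G ⧸ C(γ)`; Mathlib's subtype σ-algebra on `↥O`).
* §1 The action on `G ⧸ H` by left translation: `smul_mk_eq` (`g • yH = (g y)H`); that the orbit maps `g ↦ g • q` are open ∕ continuous is ★ `isOpenMap_smul_quotient` ∕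
  ★ `continuous_smul_quotient` of `Automorphic/InvariantMeasureDomination` (imported, not restated).
* §2 Consequences of `he` for any orbit map `f : G ⧸ C(γ) → ↥O` with `f(yC) = y γ y⁻¹` (e.g. `f = e`): `coe_orbitMap_smul` (`f (g • q) = g (f q) g⁻¹`),
  `conj_mem_of_orbitMap` (`O` is conjugation-stable), `eq_setOf_conj_of_orbitMap`, `exists_conj_eq_of_orbitMap` (transitivity), `isPretransitive_of_orbitMap`
  (instance form for a consumer's action `[MulAction Γ ↥O]` through `φ : G → Γ`); `coe_toConjAct_smul_orbit` (the `hsmul` token for `Γ := ConjAct G`).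
* §3 Topology along the homeomorphism `e`: `equiv_symm_conj` (`e⁻¹ (g x g⁻¹) = g • e⁻¹ x`), `smul_eq_equiv_smul_symm`, (T4) `isOpenMap_conj_mk_of_equiv` (orbit maps
  `G → ↥O` open), the Γ-forms `isOpenMap_smul_of_equiv`, `continuousSMul_of_equiv`; `continuous_conj_subtype`, `continuous_conj_mk_of_equiv`.
* §4 The transported measure `μ.map e`: (T1) `map_conj_map_equiv` — `(μ.map e).map (x ↦ g x g⁻¹) = μ.map e` for `μ` `G`-invariant — and the Γ-instance form
  `smulInvariantMeasure_map_equiv`; (T2) `isFiniteMeasureOnCompacts_map_equiv` (= Mathlib `IsFiniteMeasureOnCompacts.map μ e`, recorded next to (T1)∕(T3)); (T3)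
  `isOpenPosMeasure_map_equiv` (`μ ≠ 0` invariant, `G` σ-compact ⇒ `μ.map e` positive on opens: ★ :67 on `G ⧸ C(γ)` + Mathlib `Continuous.isOpenPosMeasure_map`),
  `map_equiv_eq_zero_iff`; set form `map_equiv_apply_preimage_val`.
* §5 Change of variables: (T5) `integral_map_equiv_eq_orbitalIntegral` — `∫ x : ↥O, F x ∂(μ.map e) = orbitalIntegral γ F μ` for EVERY `F : G → E` (Mathlib `integral_map_equiv`,
  no measurability hypothesis) — and the `Quotient.out` dress `integral_map_equiv_eq_classOrbitalIntegral` for an `OrbitalMeasureFamily`; (T6)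
  `integrable_map_equiv_iff` — `Integrable (F ∘ (↑)) (μ.map e) ↔ Integrable (descConj γ C(γ) _ F) μ` (Mathlib `integrable_map_equiv`).
HONEST LABEL: measure-theoretic bookkeeping, count-neutral, pays no letter by itself; HC_CM is proved only modulo the 7 printed citations (2 remaining:
hLiu418 = stmt-HodgeConjecture-24832, h413 = stmt-HodgeConjecture-24833) until rung 0 closes.

## Mathlib ∕ tree search
Mathlib: `IsFiniteMeasureOnCompacts.map (μ) (f : α ≃ₜ β)`, `smulInvariantMeasure_map`, `MeasureTheory.map_smul`, `Continuous.isOpenPosMeasure_map`,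
`integral_map_equiv`, `integrable_map_equiv`, `MulAction.Quotient.smul_mk`, `Subtype.borelSpace` — all consumed by name.  Tree: ★ `InvariantMeasureDomination`
(`isOpenMap_smul_quotient`, `continuous_smul_quotient` — the orbit maps of `G ⧸ H`), ★ `OrbitMeasureOfClosedClass` (push-forward TO `G` along `descConj … id` for CLOSED classes; this file is the push-forward to the
class as a SUBTYPE along a homeomorphism, the shape COINV-1 consumes), ★ `ConjClassClosedEmbedding` ∕ `LocalOrbitalIntegrand` (`range_descConj_id`,
`injective_descConj_id_centralizer`, `continuous_descConj_id`), ★ `InvariantQuotientOrbitalTransport` (transport between two quotients `G ⧸ M → G′ ⧸ M′`, different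
object).  Nothing restated.

## References
* [BernsteinZelevinsky1976] I. N. Bernstein, A. V. Zelevinsky, *Representations of the group GL(n, F) where F is a non-archimedean local field*, Russian Math.
  Surveys 31:3 (1976), §1.18 (invariant distributions on homogeneous spaces), §1.5.
* [Rogawski1990] J. Rogawski, *Automorphic Representations of Unitary Groups in Three Variables*, Ann. of Math. Stud. 123 (1990), §8.1 p. 113 (measures on the
  unipotent classes, their orbital integrals), §4.9 p. 54 (orbital integrals).
* [DeitmarEchterhoff2014] A. Deitmar, S. Echterhoff, *Principles of Harmonic Analysis*, 2nd ed. (2014), Lemma 9.3.3 (orbit measures of closed classes).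
-/

set_option autoImplicit false

noncomputable section

open MeasureTheory Measure Topology Set Filter MulAction
open Literature.NumberTheory.Automorphic

namespace Literature.MeasureTheory.Group

/-! ## §1 The left-translation action of `G` on `G ⧸ H` (orbit maps open ∕ continuous: ★ `InvariantMeasureDomination`) -/

section Quotient

variable {G : Type*} [Group G] (H : Subgroup G)

/-- `g • (yH) = (g y)H` for the left-translation action of `G` on `G ⧸ H` (Mathlib `MulAction.Quotient.smul_mk`, multiplicative spelling).
[cite: BernsteinZelevinsky1976, §1.5] -/
theorem smul_mk_eq (g y : G) : g • (QuotientGroup.mk y : G ⧸ H) = QuotientGroup.mk (g * y) :=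
  MulAction.Quotient.smul_mk H g y

end Quotient

/-! ## §2 A conjugation-equivariant orbit map `f : G ⧸ C(γ) → ↥O`, `f(yC) = y γ y⁻¹`: algebraic consequences -/

section OrbitMap

variable {G : Type*} [Group G] (γ : G) {O : Set G} (f : G ⧸ Subgroup.centralizer ({γ} : Set G) → ↥O)
  (hf : ∀ g : G, (f (QuotientGroup.mk g) : G) = g * γ * g⁻¹)
include hf

/-- **Equivariance on all of `G ⧸ C(γ)`**: `f (g • q) = g · f(q) · g⁻¹`. [cite: BernsteinZelevinsky1976, §1.5] -/
theorem coe_orbitMap_smul (g : G) (q : G ⧸ Subgroup.centralizer ({γ} : Set G)) : (f (g • q) : G) = g * (f q : G) * g⁻¹ := by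
  induction q using QuotientGroup.induction_on with
  | H y =>
    rw [smul_mk_eq, hf, hf]
    simp only [mul_inv_rev, mul_assoc]

/-- `O` is stable under conjugation (when the orbit map is onto `O`). [cite: BernsteinZelevinsky1976, §1.5] -/
theorem conj_mem_of_orbitMap (hfs : Function.Surjective f) (g : G) {x : G} (hx : x ∈ O) : g * x * g⁻¹ ∈ O := by
  obtain ⟨q, hq⟩ := hfs ⟨x, hx⟩
  have hx' : x = (f q : G) := by rw [hq]
  rw [hx', ← coe_orbitMap_smul γ f hf g q]
  exact (f (g • q)).2

/-- `O` IS the conjugacy class of `γ`: `O = {x | ∃ y, y γ y⁻¹ = x}` (so `O` may be spelled as the class in any of the tree's forms). [cite: BernsteinZelevinsky1976, §1.5] -/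
theorem eq_setOf_conj_of_orbitMap (hfs : Function.Surjective f) : O = {x | ∃ y : G, y * γ * y⁻¹ = x} := by
  ext x
  constructor
  · intro hx
    obtain ⟨q, hq⟩ := hfs ⟨x, hx⟩
    induction q using QuotientGroup.induction_on with
    | H y => exact ⟨y, by rw [← hf, hq]⟩
  · rintro ⟨y, rfl⟩
    rw [← hf]
    exact (f (QuotientGroup.mk y)).2

/-- **Transitivity**: any two points of `O` are conjugate (when the orbit map is onto `O`). [cite: BernsteinZelevinsky1976, §1.5] -/
theorem exists_conj_eq_of_orbitMap (hfs : Function.Surjective f) (x y : ↥O) : ∃ g : G, g * (x : G) * g⁻¹ = y := by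
  obtain ⟨a, ha⟩ := hfs x
  obtain ⟨b, hb⟩ := hfs y
  induction a using QuotientGroup.induction_on with
  | H a =>
    induction b using QuotientGroup.induction_on with
    | H b =>
      refine ⟨b * a⁻¹, ?_⟩
      rw [← ha, ← hb, hf, hf]
      simp only [mul_inv_rev, inv_inv, mul_assoc, inv_mul_cancel_left]

/-- **Transitivity, instance form**: a conjugation action of a monoid `Γ` on `↥O` realised through `φ : G → Γ` (`(φ g • x : G) = g x g⁻¹`) is pretransitive.
[cite: BernsteinZelevinsky1976, §1.5] -/
theorem isPretransitive_of_orbitMap (hfs : Function.Surjective f) {Γ : Type*} [Monoid Γ] [MulAction Γ ↥O] (φ : G → Γ)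
    (hsmul : ∀ (g : G) (x : ↥O), ((φ g • x : ↥O) : G) = g * (x : G) * g⁻¹) : MulAction.IsPretransitive Γ ↥O :=
  ⟨fun x y => by
    obtain ⟨g, hg⟩ := exists_conj_eq_of_orbitMap γ f hf hfs x y
    exact ⟨φ g, Subtype.ext (by rw [hsmul, hg])⟩⟩

end OrbitMap

section ConjActToken

variable {G : Type*} [Group G] (γ : G)

/-- **The `hsmul` token for Mathlib's `ConjAct` currency**: on the orbit `↥(MulAction.orbit (ConjAct G) γ)` with Mathlib's instance `MulAction (ConjAct G) ↥(orbit …)`,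
`(toConjAct g • x : G) = g x g⁻¹` — so every Γ-form of this file applies with `Γ := ConjAct G`, `φ := ConjAct.toConjAct` (a bijection). [cite: BernsteinZelevinsky1976, §1.5] -/
theorem coe_toConjAct_smul_orbit (g : G) (x : ↥(MulAction.orbit (ConjAct G) γ)) :
    ((ConjAct.toConjAct g • x : ↥(MulAction.orbit (ConjAct G) γ)) : G) = g * (x : G) * g⁻¹ := by
  rw [MulAction.orbit.coe_smul, ConjAct.smul_def, ConjAct.ofConjAct_toConjAct]

end ConjActToken

/-! ## §3 A conjugation-equivariant HOMEOMORPHISM `e : G ⧸ C(γ) ≃ₜ ↥O`: open orbit maps, continuity of the action -/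

section Topology

variable {G : Type*} [Group G] [TopologicalSpace G] [IsTopologicalGroup G] (γ : G)
  {O : Set G} (e : G ⧸ Subgroup.centralizer ({γ} : Set G) ≃ₜ ↥O) (he : ∀ g : G, (e (QuotientGroup.mk g) : G) = g * γ * g⁻¹)

/-- The conjugation map `x ↦ g x g⁻¹` of a conjugation-stable `↥O` is continuous. [cite: BernsteinZelevinsky1976, §1.5] -/
theorem continuous_conj_subtype (hO : ∀ (g : G) {x : G}, x ∈ O → g * x * g⁻¹ ∈ O) (g : G) :
    Continuous fun x : ↥O => (⟨g * (x : G) * g⁻¹, hO g x.2⟩ : ↥O) :=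
  ((continuous_const.mul continuous_subtype_val).mul continuous_const).subtype_mk _

include he

omit [IsTopologicalGroup G] in
/-- The inverse identification is equivariant: `e⁻¹ (g x g⁻¹) = g • e⁻¹ x`. [cite: BernsteinZelevinsky1976, §1.5] -/
theorem equiv_symm_conj (g : G) (x : ↥O) :
    e.symm ⟨g * (x : G) * g⁻¹, conj_mem_of_orbitMap γ e he e.surjective g x.2⟩ = g • e.symm x := by
  apply e.injective
  apply Subtype.ext
  rw [e.apply_symm_apply, coe_orbitMap_smul γ e he, e.apply_symm_apply]

omit [IsTopologicalGroup G] in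
/-- For an action `[SMul Γ ↥O]` through `φ : G → Γ` realising conjugation: `φ g • x = e (g • e⁻¹ x)`. [cite: BernsteinZelevinsky1976, §1.5] -/
theorem smul_eq_equiv_smul_symm {Γ : Type*} [SMul Γ ↥O] (φ : G → Γ) (hsmul : ∀ (g : G) (x : ↥O), ((φ g • x : ↥O) : G) = g * (x : G) * g⁻¹)
    (g : G) (x : ↥O) : φ g • x = e (g • e.symm x) := by
  apply Subtype.ext
  rw [hsmul, coe_orbitMap_smul γ e he, e.apply_symm_apply]

/-- **(T4) THE ORBIT MAPS INTO THE CLASS ARE OPEN**: for every `x ∈ O`, `g ↦ g x g⁻¹ : G → ↥O` is an open map (it is `e ∘ (g ↦ g • e⁻¹ x)`, an open orbit map of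
`G ⧸ C(γ)` followed by the homeomorphism `e`).  No σ-compactness is needed GIVEN `e`. [cite: BernsteinZelevinsky1976, §1.18] -/
theorem isOpenMap_conj_mk_of_equiv (x : ↥O) :
    IsOpenMap fun g : G => (⟨g * (x : G) * g⁻¹, conj_mem_of_orbitMap γ e he e.surjective g x.2⟩ : ↥O) := by
  have hfun : (fun g : G => (⟨g * (x : G) * g⁻¹, conj_mem_of_orbitMap γ e he e.surjective g x.2⟩ : ↥O)) = e ∘ fun g : G => g • e.symm x := by
    funext g
    apply Subtype.ext
    change g * (x : G) * g⁻¹ = (e (g • e.symm x) : G)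
    rw [coe_orbitMap_smul γ e he, e.apply_symm_apply]
  rw [hfun]
  exact e.isOpenMap.comp (isOpenMap_smul_quotient _ (e.symm x))

/-- The orbit maps into the class are continuous. [cite: BernsteinZelevinsky1976, §1.18] -/
theorem continuous_conj_mk_of_equiv (x : ↥O) :
    Continuous fun g : G => (⟨g * (x : G) * g⁻¹, conj_mem_of_orbitMap γ e he e.surjective g x.2⟩ : ↥O) :=
  ((continuous_id.mul continuous_const).mul continuous_id.inv).subtype_mk _

/-- **(T4, instance form) OPEN ORBIT MAPS FOR THE CONSUMER'S ACTION**: if `Γ` (a topological space) acts on `↥O` through a CONTINUOUS SURJECTIVE `φ : G → Γ`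
realising conjugation, then every orbit map `c ↦ c • x : Γ → ↥O` is open (the hypothesis `hopen` of ★ COINV-1). [cite: BernsteinZelevinsky1976, §1.18] -/
theorem isOpenMap_smul_of_equiv {Γ : Type*} [TopologicalSpace Γ] [SMul Γ ↥O] (φ : G → Γ) (hφc : Continuous φ) (hφs : Function.Surjective φ)
    (hsmul : ∀ (g : G) (x : ↥O), ((φ g • x : ↥O) : G) = g * (x : G) * g⁻¹) (x : ↥O) : IsOpenMap fun c : Γ => c • x := by
  intro U hU
  have himage : (fun c : Γ => c • x) '' U =
      (fun g : G => (⟨g * (x : G) * g⁻¹, conj_mem_of_orbitMap γ e he e.surjective g x.2⟩ : ↥O)) '' (φ ⁻¹' U) := by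
    ext y
    constructor
    · rintro ⟨c, hc, rfl⟩
      obtain ⟨g, rfl⟩ := hφs c
      exact ⟨g, hc, Subtype.ext (by rw [hsmul])⟩
    · rintro ⟨g, hg, rfl⟩
      exact ⟨φ g, hg, Subtype.ext (by rw [hsmul])⟩
  rw [himage]
  exact isOpenMap_conj_mk_of_equiv γ e he x _ (hU.preimage hφc)

/-- **Continuity of the consumer's action** when `φ : G ≃ₜ Γ` is a homeomorphism realising conjugation: `ContinuousSMul Γ ↥O`.
[cite: BernsteinZelevinsky1976, §1.5] -/
theorem continuousSMul_of_equiv {Γ : Type*} [TopologicalSpace Γ] [SMul Γ ↥O] (φ : G ≃ₜ Γ)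
    (hsmul : ∀ (g : G) (x : ↥O), ((φ g • x : ↥O) : G) = g * (x : G) * g⁻¹) : ContinuousSMul Γ ↥O := by
  refine ⟨?_⟩
  have hfun : (fun p : Γ × ↥O => p.1 • p.2) = fun p : Γ × ↥O =>
      (⟨φ.symm p.1 * (p.2 : G) * (φ.symm p.1)⁻¹, conj_mem_of_orbitMap γ e he e.surjective (φ.symm p.1) p.2.2⟩ : ↥O) := by
    funext p
    apply Subtype.ext
    have h := hsmul (φ.symm p.1) p.2
    rw [φ.apply_symm_apply] at h
    exact h
  rw [hfun]
  exact (((φ.symm.continuous.comp continuous_fst).mul (continuous_subtype_val.comp continuous_snd)).mul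
    (φ.symm.continuous.comp continuous_fst).inv).subtype_mk _

end Topology

/-! ## §4 The transported measure `μ.map e` on the class -/

section Transport

variable {G : Type*} [Group G] [TopologicalSpace G] [IsTopologicalGroup G] [MeasurableSpace G] [BorelSpace G] (γ : G)
  [MeasurableSpace (G ⧸ Subgroup.centralizer ({γ} : Set G))] [BorelSpace (G ⧸ Subgroup.centralizer ({γ} : Set G))]
  {O : Set G} (e : G ⧸ Subgroup.centralizer ({γ} : Set G) ≃ₜ ↥O) (he : ∀ g : G, (e (QuotientGroup.mk g) : G) = g * γ * g⁻¹)
  (μ : Measure (G ⧸ Subgroup.centralizer ({γ} : Set G)))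

omit [IsTopologicalGroup G] in
/-- `μ.map e = 0 ↔ μ = 0` (Mathlib `Measure.map_eq_zero_iff`). [cite: BernsteinZelevinsky1976, §1.18] -/
theorem map_equiv_eq_zero_iff : μ.map e = 0 ↔ μ = 0 :=
  Measure.map_eq_zero_iff e.continuous.measurable.aemeasurable

omit [IsTopologicalGroup G] in
/-- **(T2) FINITENESS ON COMPACTA** of the transported measure — Mathlib `IsFiniteMeasureOnCompacts.map` along the homeomorphism `e` (recorded in the file's binders so
that consumers find it next to (T1) and (T3)). [cite: BernsteinZelevinsky1976, §1.18] -/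
theorem isFiniteMeasureOnCompacts_map_equiv [IsFiniteMeasureOnCompacts μ] : IsFiniteMeasureOnCompacts (μ.map e) :=
  IsFiniteMeasureOnCompacts.map μ e

/-- **(T3) POSITIVITY ON OPENS**: for `G` σ-compact and `μ ≠ 0` invariant on `G ⧸ C(γ)`, the transported measure charges every non-empty relatively open subset of the
class (★ `isOpenPosMeasure_of_smulInvariantMeasure_ne_zero` on the homogeneous space `G ⧸ C(γ)`, then Mathlib `Continuous.isOpenPosMeasure_map` along the surjection `e`).
[cite: BernsteinZelevinsky1976, §1.18] -/
theorem isOpenPosMeasure_map_equiv [SigmaCompactSpace G] [SMulInvariantMeasure G (G ⧸ Subgroup.centralizer ({γ} : Set G)) μ] (hμ : μ ≠ 0) :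
    (μ.map e).IsOpenPosMeasure := by
  haveI : μ.IsOpenPosMeasure :=
    isOpenPosMeasure_of_smulInvariantMeasure_ne_zero (G := G) (continuous_smul_quotient (Subgroup.centralizer ({γ} : Set G))) μ hμ
  exact e.continuous.isOpenPosMeasure_map e.surjective

include he

/-- **(T1) INVARIANCE OF THE TRANSPORTED MEASURE, instance-free**: for `μ` invariant under left translation on `G ⧸ C(γ)`, the push-forward `μ.map e` is invariant
under every conjugation `x ↦ g x g⁻¹` of the class. [cite: BernsteinZelevinsky1976, §1.18] [cite: Rogawski1990, §8.1 p. 113] -/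
theorem map_conj_map_equiv [SMulInvariantMeasure G (G ⧸ Subgroup.centralizer ({γ} : Set G)) μ] (g : G) :
    (μ.map e).map (fun x : ↥O => (⟨g * (x : G) * g⁻¹, conj_mem_of_orbitMap γ e he e.surjective g x.2⟩ : ↥O)) = μ.map e := by
  have hfun : (fun x : ↥O => (⟨g * (x : G) * g⁻¹, conj_mem_of_orbitMap γ e he e.surjective g x.2⟩ : ↥O)) ∘ e = e ∘ fun q => g • q := by
    funext q
    apply Subtype.ext
    change g * (e q : G) * g⁻¹ = (e (g • q) : G)
    rw [coe_orbitMap_smul γ e he]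
  have hmeas : Measurable fun x : ↥O => (⟨g * (x : G) * g⁻¹, conj_mem_of_orbitMap γ e he e.surjective g x.2⟩ : ↥O) :=
    (continuous_conj_subtype (fun g' _ hx => conj_mem_of_orbitMap γ e he e.surjective g' hx) g).measurable
  rw [Measure.map_map hmeas e.continuous.measurable, hfun, ← Measure.map_map e.continuous.measurable (measurable_const_smul g),
    MeasureTheory.map_smul]

/-- **(T1, instance form) `SMulInvariantMeasure Γ ↥O (μ.map e)`** for ANY action of a type `Γ` on `↥O` through a SURJECTIVE `φ : G → Γ` realising conjugation (e.g.
`Γ = ConjAct G`, or `G` with a locally built conjugation action) — the invariance hypothesis of ★ COINV-1. [cite: BernsteinZelevinsky1976, §1.18] -/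
theorem smulInvariantMeasure_map_equiv [SMulInvariantMeasure G (G ⧸ Subgroup.centralizer ({γ} : Set G)) μ] {Γ : Type*} [SMul Γ ↥O] (φ : G → Γ)
    (hφs : Function.Surjective φ) (hsmul : ∀ (g : G) (x : ↥O), ((φ g • x : ↥O) : G) = g * (x : G) * g⁻¹) :
    SMulInvariantMeasure Γ ↥O (μ.map e) := by
  refine ⟨fun c s hs => ?_⟩
  obtain ⟨g, rfl⟩ := hφs c
  have hfun : (fun x : ↥O => φ g • x) = fun x : ↥O => (⟨g * (x : G) * g⁻¹, conj_mem_of_orbitMap γ e he e.surjective g x.2⟩ : ↥O) := by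
    funext x
    exact Subtype.ext (hsmul g x)
  have hmeas : Measurable fun x : ↥O => (⟨g * (x : G) * g⁻¹, conj_mem_of_orbitMap γ e he e.surjective g x.2⟩ : ↥O) :=
    (continuous_conj_subtype (fun g' _ hx => conj_mem_of_orbitMap γ e he e.surjective g' hx) g).measurable
  rw [hfun, ← Measure.map_apply hmeas hs, map_conj_map_equiv γ e he μ g]

omit [IsTopologicalGroup G] in
/-- **Set form of the transport**: `(μ.map e)(O ∩ S) = μ {yC | y γ y⁻¹ ∈ S}` for measurable `S ⊆ G` (the orbit map `descConj γ C(γ) _ id` of ★ `LocalOrbitalIntegrand`).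
[cite: Rogawski1990, §8.1 p. 113] -/
theorem map_equiv_apply_preimage_val {S : Set G} (hS : MeasurableSet S) :
    (μ.map e) (Subtype.val ⁻¹' S) =
      μ (descConj γ (Subgroup.centralizer ({γ} : Set G)) (fun _ hg => Subgroup.mem_centralizer_singleton_iff.1 hg) id ⁻¹' S) := by
  rw [Measure.map_apply e.continuous.measurable (measurable_subtype_coe hS)]
  congr 1
  ext q
  induction q using QuotientGroup.induction_on with
  | H y =>
    simp only [Set.mem_preimage, descConj_mk, id]
    rw [he]

end Transport

/-! ## §5 Change of variables: integrals over the class against `μ.map e` ARE orbital integrals -/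

section Integrand

variable {G : Type*} [Group G] (γ : G) {O : Set G} (f : G ⧸ Subgroup.centralizer ({γ} : Set G) → ↥O)
  (hf : ∀ g : G, (f (QuotientGroup.mk g) : G) = g * γ * g⁻¹) {E : Type*}
include hf

/-- The orbital integrand IS `F` read through the orbit map: `F (f q) = descConj γ C(γ) _ F q`. [cite: Rogawski1990, §4.9 p. 54] -/
theorem comp_orbitMap_eq_descConj (F : G → E) :
    (fun q => F (f q : G)) = descConj γ (Subgroup.centralizer ({γ} : Set G)) (fun _ hg => Subgroup.mem_centralizer_singleton_iff.1 hg) F := by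
  funext q
  induction q using QuotientGroup.induction_on with
  | H y => rw [descConj_mk, hf]

end Integrand

section Integral

variable {G : Type*} [Group G] [TopologicalSpace G] [MeasurableSpace G] [BorelSpace G] (γ : G)
  [MeasurableSpace (G ⧸ Subgroup.centralizer ({γ} : Set G))] [BorelSpace (G ⧸ Subgroup.centralizer ({γ} : Set G))]
  {O : Set G} (e : G ⧸ Subgroup.centralizer ({γ} : Set G) ≃ₜ ↥O) (he : ∀ g : G, (e (QuotientGroup.mk g) : G) = g * γ * g⁻¹)
  (μ : Measure (G ⧸ Subgroup.centralizer ({γ} : Set G))) {E : Type*} [NormedAddCommGroup E]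
include he

/-- **(T6) INTEGRABILITY TRANSFER**: `F|_O` is integrable against `μ.map e` iff the orbital integrand `yC ↦ F(y γ y⁻¹)` is integrable against `μ` (Mathlib
`integrable_map_equiv`). [cite: Rogawski1990, §4.9 p. 54] -/
theorem integrable_map_equiv_iff (F : G → E) :
    Integrable (fun x : ↥O => F (x : G)) (μ.map e) ↔
      Integrable (descConj γ (Subgroup.centralizer ({γ} : Set G)) (fun _ hg => Subgroup.mem_centralizer_singleton_iff.1 hg) F) μ := by
  rw [← comp_orbitMap_eq_descConj γ e he F, ← Homeomorph.toMeasurableEquiv_coe, integrable_map_equiv]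
  exact Iff.rfl

variable [NormedSpace ℝ E]

/-- **(T5) CHANGE OF VARIABLES**: `∫_{x ∈ O} F(x) d(μ.map e)(x) = orbitalIntegral γ F μ = ∫_{G ⧸ C(γ)} F(y γ y⁻¹) dμ(y)` for EVERY `F : G → E` (Mathlib `integral_map_equiv`
along the measurable equivalence `e`; no measurability hypothesis). [cite: Rogawski1990, §4.9 p. 54] [cite: BernsteinZelevinsky1976, §1.18] -/
theorem integral_map_equiv_eq_orbitalIntegral (F : G → E) : ∫ x : ↥O, F (x : G) ∂(μ.map e) = orbitalIntegral γ F μ := by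
  rw [orbitalIntegral_eq_integral_descConj, ← comp_orbitMap_eq_descConj γ e he F, ← Homeomorph.toMeasurableEquiv_coe, integral_map_equiv]

/-- (T5) in `descConj` currency: `∫_{O} F d(μ.map e) = ∫ q, descConj γ C(γ) _ F q ∂μ`. [cite: Rogawski1990, §4.9 p. 54] -/
theorem integral_map_equiv_eq_integral_descConj (F : G → E) :
    ∫ x : ↥O, F (x : G) ∂(μ.map e) =
      ∫ q, descConj γ (Subgroup.centralizer ({γ} : Set G)) (fun _ hg => Subgroup.mem_centralizer_singleton_iff.1 hg) F q ∂μ := by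
  rw [integral_map_equiv_eq_orbitalIntegral γ e he μ F, orbitalIntegral_eq_integral_descConj]

end Integral

section ClassIntegral

variable {G : Type*} [Group G] [TopologicalSpace G] [MeasurableSpace G] [BorelSpace G]
  [∀ γ : G, MeasurableSpace (G ⧸ Subgroup.centralizer ({γ} : Set G))] [∀ γ : G, BorelSpace (G ⧸ Subgroup.centralizer ({γ} : Set G))]
  {E : Type*} [NormedAddCommGroup E]

/-- **(T6, `Quotient.out` dress)**: integrability over the class against `(m c).map e` iff the orbital integrand at `Quotient.out c` is `m c`-integrable — the Ranga-Rao
clause in either currency. [cite: Rogawski1990, §8.1 p. 113] -/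
theorem integrable_map_equiv_iff_classRep (m : OrbitalMeasureFamily G) (c : ConjClasses G) {O : Set G}
    (e : G ⧸ Subgroup.centralizer ({(Quotient.out c : G)} : Set G) ≃ₜ ↥O) (he : ∀ g : G, (e (QuotientGroup.mk g) : G) = g * (Quotient.out c : G) * g⁻¹)
    (F : G → E) :
    Integrable (fun x : ↥O => F (x : G)) ((m c).map e) ↔
      Integrable (descConj (Quotient.out c : G) (Subgroup.centralizer ({(Quotient.out c : G)} : Set G))
        (fun _ hg => Subgroup.mem_centralizer_singleton_iff.1 hg) F) (m c) :=
  integrable_map_equiv_iff (Quotient.out c : G) e he (m c) F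

variable [NormedSpace ℝ E]

/-- **(T5, `Quotient.out` dress) FOR AN ORBITAL MEASURE FAMILY**: at a class `c` with representative `γ_c = Quotient.out c`, an identification `e : G ⧸ C(γ_c) ≃ₜ ↥O`,
`e(yC) = y γ_c y⁻¹`, turns the class-function orbital integral into an integral over the class: `∫_{O} F d((m c).map e) = classOrbitalIntegral m F c`.
[cite: Rogawski1990, §4.9 p. 54; §8.1 p. 113] -/
theorem integral_map_equiv_eq_classOrbitalIntegral (m : OrbitalMeasureFamily G) (c : ConjClasses G) {O : Set G}
    (e : G ⧸ Subgroup.centralizer ({(Quotient.out c : G)} : Set G) ≃ₜ ↥O) (he : ∀ g : G, (e (QuotientGroup.mk g) : G) = g * (Quotient.out c : G) * g⁻¹)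
    (F : G → E) : ∫ x : ↥O, F (x : G) ∂((m c).map e) = classOrbitalIntegral m F c := by
  rw [classOrbitalIntegral_eq, integral_map_equiv_eq_orbitalIntegral (Quotient.out c : G) e he (m c) F]

end ClassIntegral

end Literature.MeasureTheory.Group

end
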